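import Summits.CriticalPhenomena.SAWScalingLimit.Theorems.SAWDefectDecoherenceBoundaryClosureRInnerPolygonsComplement
import HarnessLib

/-!
# Crux `BoundaryClosureR` (stmt-CriticalPhenomena-14004), line `polygon-parity-squeeze`,
# stub `stub_innerPolygons` (IP): the two sides of a flat boundary piece of a Jordan carrier

Landing target:
`Summits/CriticalPhenomena/SAWScalingLimit/Theorems/SAWDefectDecoherenceBoundaryClosureRInnerPolygonsTwoSides.lean`
(`--supports stmt-CriticalPhenomena-14004`; building block of the registered stub `stub_innerPolygons`,
hypothesis (IP) of the landed squeeze `PolygonParitySqueeze.squeeze_of_innerPolygons`).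

The inner exact polygon `P` of the squeeze is the inside (`polygonDomain`) of the boundary cycle `γ`
of a pinch-free union of lattice triangles; to identify `P ∩ ball z r` with a zigzag half-plane /
wedge at every boundary point one reads off, edge by edge, WHICH side of `γ` is inside.  This file
proves the local form of the Jordan curve theorem that does it:

* `mem_carrier_or_outside` — off the boundary curve a point lies in the carrier or in the outside;
* `halfBall_subset_carrier_or` — **the two sides of a flat boundary piece**: if inside `ball m ε`
  the frontier of a Jordan carrier is the straight line through `m` with normal `n`, then one open
  half-ball lies in the carrier and the other in its complement (each half-ball is convex and misses
  the curve, so it lies inside or outside; both on one side would put `m` off the closure of the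
  other side, whereas `∂(inside) = ∂(outside)` — `compl_carrier_eq_closure_outside`).

Sources: J. McCleary, *A First Course in Topology* (2006), Ch. 9 (Jordan curve theorem; tree:
`JordanCurveTheorem_holds`, `JordanDomain.exists_outside`).  No definition and no named fact is
introduced.
-/

noncomputable section

open Set Metric
open Literature.Probability.RandomPlanarGeometry

namespace Summit.CriticalPhenomena.SAWScalingLimit.Theorems.PolygonParitySqueeze

/-- Off the boundary curve, a point is in the carrier or in the outside. [folklore] -/
theorem mem_carrier_or_outside {D : JordanDomain} {V : Set ℂ} (hfV : frontier V = frontier D.carrier)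
    (heq : D.carrierᶜ = closure V) {z : ℂ} (hz : z ∉ frontier D.carrier) : z ∈ D.carrier ∨ z ∈ V := by
  by_cases hzD : z ∈ D.carrier
  · exact Or.inl hzD
  · right
    have : z ∈ closure V := by rw [← heq]; exact hzD
    rw [closure_eq_self_union_frontier, hfV] at this
    exact this.resolve_right hz

/-- **The two sides of a flat boundary piece** (Jordan curve theorem, local form): if inside
`ball m ε` the frontier of a Jordan carrier is the straight line through `m` with unit normal `n`,
then one of the two open half-balls lies in the carrier and the other one in its complement (each
half-ball is connected and misses the curve, so it lies in the inside or in the outside; both on the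
same side would put `m` off the closure of the other side, whereas `∂(inside) = ∂(outside)`).  This is
how the inner-polygon construction reads off, edge by edge, which side of its boundary polygon is
inside. [cite: Mccleary2006, Ch. 9 (Jordan curve theorem)] -/
theorem halfBall_subset_carrier_or : ∀ (D : JordanDomain) (m n : ℂ) (ε : ℝ), 0 < ε → frontier D.carrier ∩ Metric.ball m ε = {w : ℂ | ((w - m) * (starRingEnd ℂ) n).re = 0} ∩ Metric.ball m ε → ({w : ℂ | 0 < ((w - m) * (starRingEnd ℂ) n).re} ∩ Metric.ball m ε ⊆ D.carrier ∧ {w : ℂ | ((w - m) * (starRingEnd ℂ) n).re < 0} ∩ Metric.ball m ε ⊆ D.carrierᶜ) ∨ ({w : ℂ | ((w - m) * (starRingEnd ℂ) n).re < 0} ∩ Metric.ball m ε ⊆ D.carrier ∧ {w : ℂ | 0 < ((w - m) * (starRingEnd ℂ) n).re} ∩ Metric.ball m ε ⊆ D.carrierᶜ) := by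
  intro D m n ε hε hfr
  obtain ⟨V, hVo, -, hDV, -, hfV, heq⟩ := compl_carrier_eq_closure_outside D
  set f : ℂ → ℝ := fun w => ((w - m) * (starRingEnd ℂ) n).re with hf
  have hfc : Continuous f := by fun_prop
  have hflin : ∀ (a b : ℝ) (w w' : ℂ), a + b = 1 → f (a • w + b • w') = a * f w + b * f w' := by
    intro a b w w' hab
    simp only [hf, Complex.real_smul]
    have : ((a : ℂ) * w + (b : ℂ) * w' - m) = (a : ℂ) * (w - m) + (b : ℂ) * (w' - m) := by
      have hab' : (a : ℂ) + (b : ℂ) = 1 := by exact_mod_cast hab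
      linear_combination (m : ℂ) * hab'
    rw [this, add_mul, Complex.add_re, mul_assoc, mul_assoc, Complex.re_ofReal_mul, Complex.re_ofReal_mul]
  set Hp : Set ℂ := {w : ℂ | 0 < f w} ∩ ball m ε with hHp
  set Hm : Set ℂ := {w : ℂ | f w < 0} ∩ ball m ε with hHm
  -- convexity, hence preconnectedness, of the two half-balls
  have hcp : Convex ℝ {w : ℂ | 0 < f w} := by
    intro w hw w' hw' a b ha hb hab
    simp only [Set.mem_setOf_eq] at hw hw' ⊢
    rw [hflin a b w w' hab]
    rcases ha.lt_or_eq with ha' | rfl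
    · nlinarith [mul_nonneg hb hw'.le]
    · simp only [zero_add] at hab; subst hab; simpa using hw'
  have hcm : Convex ℝ {w : ℂ | f w < 0} := by
    intro w hw w' hw' a b ha hb hab
    simp only [Set.mem_setOf_eq] at hw hw' ⊢
    rw [hflin a b w w' hab]
    rcases ha.lt_or_eq with ha' | rfl
    · nlinarith [mul_nonpos_iff.2 (Or.inl ⟨hb, hw'.le⟩)]
    · simp only [zero_add] at hab; subst hab; simpa using hw'
  have hHpc : IsPreconnected Hp := (hcp.inter (convex_ball m ε)).isPreconnected
  have hHmc : IsPreconnected Hm := (hcm.inter (convex_ball m ε)).isPreconnected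
  -- both half-balls miss the curve, hence lie in `D ∪ V`
  have hoff : ∀ w ∈ ball m ε, f w ≠ 0 → w ∉ frontier D.carrier := by
    intro w hw hfw hwf
    have : w ∈ frontier D.carrier ∩ ball m ε := ⟨hwf, hw⟩
    rw [hfr] at this
    exact hfw this.1
  have hsubp : Hp ⊆ D.carrier ∪ V := fun w hw =>
    mem_carrier_or_outside hfV heq (hoff w hw.2 (ne_of_gt hw.1))
  have hsubm : Hm ⊆ D.carrier ∪ V := fun w hw =>
    mem_carrier_or_outside hfV heq (hoff w hw.2 (ne_of_lt hw.1))
  have hp := hHpc.subset_or_subset D.isOpen hVo hDV hsubp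
  have hm' := hHmc.subset_or_subset D.isOpen hVo hDV hsubm
  have hVsub : V ⊆ D.carrierᶜ := fun w hw hwD => Set.disjoint_left.1 hDV hwD hw
  -- `m` is on the curve, in the closure of both sides
  have hm0 : f m = 0 := by simp [hf]
  have hmfr : m ∈ frontier D.carrier := by
    have : m ∈ {w : ℂ | ((w - m) * (starRingEnd ℂ) n).re = 0} ∩ ball m ε := ⟨hm0, mem_ball_self hε⟩
    rw [← hfr] at this
    exact this.1
  have htri : ∀ w ∈ ball m ε, w ∉ frontier D.carrier → w ∈ Hp ∨ w ∈ Hm := by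
    intro w hw hwf
    rcases lt_trichotomy (f w) 0 with h | h | h
    · exact Or.inr ⟨h, hw⟩
    · exfalso
      apply hwf
      have : w ∈ {w : ℂ | ((w - m) * (starRingEnd ℂ) n).re = 0} ∩ ball m ε := ⟨h, hw⟩
      rw [← hfr] at this
      exact this.1
    · exact Or.inl ⟨h, hw⟩
  -- a point of `V` and a point of `D` in the ball
  have hmV : m ∈ closure V := by
    have : m ∈ frontier V := by rw [hfV]; exact hmfr
    exact frontier_subset_closure this
  have hmD : m ∈ closure D.carrier := frontier_subset_closure hmfr
  obtain ⟨v, hvb, hvV⟩ : (ball m ε ∩ V).Nonempty := mem_closure_iff_nhds.1 hmV _ (ball_mem_nhds m hε)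
  obtain ⟨d, hdb, hdD⟩ : (ball m ε ∩ D.carrier).Nonempty :=
    mem_closure_iff_nhds.1 hmD _ (ball_mem_nhds m hε)
  have hvfr : v ∉ frontier D.carrier := fun h => by
    have : v ∈ V ∩ frontier V := ⟨hvV, by rw [hfV]; exact h⟩
    rw [hVo.inter_frontier_eq] at this
    exact this
  have hdfr : d ∉ frontier D.carrier := fun h => by
    have : d ∈ D.carrier ∩ frontier D.carrier := ⟨hdD, h⟩
    rw [D.isOpen.inter_frontier_eq] at this
    exact this
  rcases hp with hp | hp <;> rcases hm' with hm' | hm'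
  · -- both sides inside: the outside point `v` has nowhere to go
    exfalso
    rcases htri v hvb hvfr with h | h
    · exact Set.disjoint_left.1 hDV (hp h) hvV
    · exact Set.disjoint_left.1 hDV (hm' h) hvV
  · exact Or.inl ⟨hp, hm'.trans hVsub⟩
  · exact Or.inr ⟨hm', hp.trans hVsub⟩
  · -- both sides outside: the inside point `d` has nowhere to go
    exfalso
    rcases htri d hdb hdfr with h | h
    · exact Set.disjoint_left.1 hDV hdD (hp h)
    · exact Set.disjoint_left.1 hDV hdD (hm' h)

end Summit.CriticalPhenomena.SAWScalingLimit.Theorems.PolygonParitySqueeze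

end
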